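import Summits.ResolutionOfSingularities.ResolutionOfSingularities.Theorems.WeightedInvariantHypersurfaceLocalGameEFT3
import Summits.ResolutionOfSingularities.ResolutionOfSingularities.Theorems.WeightedInvariantIotaOrder
import Summits.ResolutionOfSingularities.ResolutionOfSingularities.Theorems.WeightedInvariantIotaOrderUpperSemicontinuous
import HarnessLib

/-!
# Lexicographic refinement of `ι`-functions: the H2a‴ `ι`-clauses (c6) (c7) (c8) (c10) (c11) (c12a) pass to
# `iotaLex Λ ι₁ ι₂ = Λ·ι₁ + ι₂` — door `HypersurfaceCentreConstruction` (stmt-ResolutionOfSingularities-19897),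
# route `WeightedInvariant`

[OURS · L1 W4.3 · cell `res-hironaka`, HUMAN RULING D-0089] Helper file `--supports stmt-ResolutionOfSingularities-19897`,
reserve volunteer res-type-073 on res-L1-w43-plan-1's (o·) desk terms (STATUS 2026-08-27T06:00:20Z).  AI-produced,
weaker than expert review.  NOT a statement of the manuscript under review (Hironaka 2017); nothing here is attributed
to its author; nothing here is a claim about resolution of singularities, and `iotaLex` is NOT offered as the witness
of the conjecture `LocalWeightedDropEFT3/4`.

## Why, and what

res-L1-w43-tri-2 TRIAGE v4 (D4) (2026-08-27T05:48:34Z; recorded by the registrar in ORDER (o20)): the clause (strat)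
EXCLUDES `ι = ord` as the EFT3 witness (specimen `z² + x³y³`: the max-`ord` locus `V(z, xy)` is not regular at the
origin), so «the witness `ι` must REFINE `ord` by an invariant of the embedded top locus, smooth-local hence
(c11)-compatible; the `ord` kernels are instances of (c7)(c8)(c10)(c11) only».  Every such refinement is a
LEXICOGRAPHIC pair whose first key is the order.  This file proves, once, that the six `ι`-only clauses of
`LocalWeightedDropEFT3` (tree module `…HypersurfaceLocalGameEFT3`, p501595) pass from the keys to the pair
`iotaLex Λ ι₁ ι₂ R g := Λ * ι₁ R g + ι₂ R g` (second key bounded by `Λ`: `IotaBoundedBy`), and isolates what the SECOND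
key owes — three STRATUM-RELATIVE facts, the honest shape of secondary invariants:
* ORDER KERNEL (`Ordinal.mul_add_div`, `Ordinal.mul_add_mod_self`): `lexPair_lt_iff : Λ*a+b < Λ*a'+b' ↔ a < a' ∨
  (a = a' ∧ b < b')` for `b, b' < Λ`, `lexPair_le_iff`, `lexPair_eq_iff`, lifted to `iotaLex_lt_iff / _le_iff / _eq_iff`
  — the currency of (strat)/(drop): the pair is stationary iff both keys are; it drops iff the first key drops, or is
  stationary while the second drops; `iotaLex_boundedBy` (pairings nest).
* CLAUSE TRANSFER: (c6) `iotaLex_isoInvariant`, (c12a) `iotaLex_unitInvariant`, (c11) `iotaLex_essSmoothCompatible`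
  (no bound needed); (c7) `iotaLex_generizationMonotone` from (c7) for `ι₁` + `IotaGenerizationMonotoneOn ι₁ ι₂`
  (second key monotone only where the first is stationary); (c10) `iotaLex_torusFactorMonotone` likewise; (c8)
  `iotaLex_upperSemicontinuous` from (c8) for `ι₁`, `Λ ≠ 0`, the bound, and `IotaUpperSemicontinuousOn ι₁ ι₂`
  (`{ι₁ = α ∧ β ≤ ι₂}` is the trace of a closed set on the stratum `{ι₁ = α}`): with `γ = Λ·(γ/Λ) + γ%Λ`,
  `{γ ≤ ιLex} = {γ/Λ < ι₁} ∪ (C ∩ {γ/Λ ≤ ι₁})` and `{a < ι₁} = {a + 1 ≤ ι₁}`.  Corollaries `…_of` for a second key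
  satisfying the plain clause.
* FIRST KEY = THE ORDER: `iotaOrd_boundedBy : IotaBoundedBy (ω + 1) iotaOrd` and `iotaLex_iotaOrd_isoInvariant /
  _unitInvariant / _generizationMonotone / _torusFactorMonotone / _upperSemicontinuous` (first-key facts from
  `WeightedInvariantIotaOrder` p502169 and `…IotaOrderUpperSemicontinuous` p502844, res-type-039).

Sorry-free, standard axioms; no new mathematics (ordinal division algorithm and point-set topology).

## References

* res-L1-w43-plan-1, `CRUX-PLAN.md` §v6.8 + Addendum 13; clause module p501595 (OURS, AI planning).
* res-L1-w43-tri-2, `L/res-L1-w43-tri-2/TRIAGE.md` §v4 (D4) (OURS, AI triage).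
* W. Sierpiński, *Cardinal and ordinal numbers* (1958), XIV §§4–5 (division algorithm for ordinals). [folklore]
-/

noncomputable section

set_option linter.dupNamespace false -- mandated namespace `Summit.<Summit>.<Problem>` of this single-conjunct summit

open IsLocalRing Polynomial AlgebraicGeometry CategoryTheory

namespace Summit.ResolutionOfSingularities.ResolutionOfSingularities.Cruxes.HypersurfaceCentreConstruction.LocalEngine

/-! ## Ordinal base-`Λ` pairing: the order kernel -/

section OrdinalPairing

variable {Λ a b a' b' : Ordinal.{0}}

/-- Quotient of the base-`Λ` pair: `(Λ*a + b) / Λ = a` for `b < Λ`. [folklore] -/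
theorem lexPair_div (hb : b < Λ) : (Λ * a + b) / Λ = a := by
  have hΛ : Λ ≠ 0 := (lt_of_le_of_lt zero_le hb).ne'
  rw [Ordinal.mul_add_div a hΛ b, Ordinal.div_eq_zero_of_lt hb, add_zero]

/-- Remainder of the base-`Λ` pair: `(Λ*a + b) % Λ = b` for `b < Λ`. [folklore] -/
theorem lexPair_mod (hb : b < Λ) : (Λ * a + b) % Λ = b := by
  rw [Ordinal.mul_add_mod_self, Ordinal.mod_eq_of_lt hb]

/-- The base-`Λ` pairing is injective on pairs with second component `< Λ`. [folklore] -/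
theorem lexPair_eq_iff (hb : b < Λ) (hb' : b' < Λ) :
    Λ * a + b = Λ * a' + b' ↔ a = a' ∧ b = b' := by
  constructor
  · intro h
    refine ⟨?_, ?_⟩
    · rw [← lexPair_div (a := a) hb, h, lexPair_div hb']
    · rw [← lexPair_mod (a := a) hb, h, lexPair_mod hb']
  · rintro ⟨rfl, rfl⟩
    rfl

/-- If the first key increases strictly, the pair increases strictly (only the left second key needs the bound).
[folklore] -/
theorem lexPair_lt_of_lt (hb : b < Λ) (h : a < a') : Λ * a + b < Λ * a' + b' := by
  calc Λ * a + b < Λ * a + Λ := (add_lt_add_iff_left _).2 hb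
    _ = Λ * (a + 1) := (mul_add_one Λ a).symm
    _ ≤ Λ * a' := mul_le_mul_right (Order.add_one_le_of_lt h) Λ
    _ ≤ Λ * a' + b' := le_self_add

/-- **Lexicographic comparison, strict form**: for second keys `< Λ`,
`Λ*a + b < Λ*a' + b' ↔ a < a' ∨ (a = a' ∧ b < b')`. [folklore] -/
theorem lexPair_lt_iff (hb : b < Λ) (hb' : b' < Λ) :
    Λ * a + b < Λ * a' + b' ↔ a < a' ∨ (a = a' ∧ b < b') := by
  constructor
  · intro h
    rcases lt_or_ge a a' with haa | haa
    · exact Or.inl haa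
    · have hle : a ≤ a' := by
        have := Ordinal.div_le_left h.le Λ
        rwa [lexPair_div hb, lexPair_div hb'] at this
      have hEq : a = a' := le_antisymm hle haa
      subst hEq
      exact Or.inr ⟨rfl, (add_lt_add_iff_left _).1 h⟩
  · rintro (h | ⟨rfl, h⟩)
    · exact lexPair_lt_of_lt hb h
    · exact (add_lt_add_iff_left _).2 h

/-- **Lexicographic comparison, weak form**: for second keys `< Λ`,
`Λ*a + b ≤ Λ*a' + b' ↔ a < a' ∨ (a = a' ∧ b ≤ b')`. [folklore] -/
theorem lexPair_le_iff (hb : b < Λ) (hb' : b' < Λ) :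
    Λ * a + b ≤ Λ * a' + b' ↔ a < a' ∨ (a = a' ∧ b ≤ b') := by
  rw [le_iff_lt_or_eq, lexPair_lt_iff hb hb', lexPair_eq_iff hb hb', le_iff_lt_or_eq]
  tauto

/-- The first key is monotone along the pairing. [folklore] -/
theorem fst_le_of_lexPair_le (hb : b < Λ) (hb' : b' < Λ) (h : Λ * a + b ≤ Λ * a' + b') : a ≤ a' := by
  rcases (lexPair_le_iff hb hb').1 h with h | ⟨h, -⟩ <;> exact h.le

/-- A pair with keys `a < Λ₁`, `b < Λ` lies below `Λ * Λ₁` (so pairings nest). [folklore] -/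
theorem lexPair_lt_mul {Λ₁ : Ordinal.{0}} (ha : a < Λ₁) (hb : b < Λ) : Λ * a + b < Λ * Λ₁ := by
  calc Λ * a + b < Λ * a + Λ := (add_lt_add_iff_left _).2 hb
    _ = Λ * (a + 1) := (mul_add_one Λ a).symm
    _ ≤ Λ * Λ₁ := mul_le_mul_right (Order.add_one_le_of_lt ha) Λ

end OrdinalPairing

/-! ## The combinator and the bound predicate -/

/-- [OURS] **Lexicographic refinement** of two `ι`-functions with base `Λ`: `iotaLex Λ ι₁ ι₂ R g = Λ·ι₁(R,g) + ι₂(R,g)`.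
When the second key takes values `< Λ` this is the lexicographic pair `(ι₁, ι₂)` read in `Ordinal`
(`iotaLex_lt_iff`). -/
def iotaLex (Λ : Ordinal.{0}) (ι₁ ι₂ : (R : Type) → [CommRing R] → R → Ordinal.{0}) :
    (R : Type) → [CommRing R] → R → Ordinal.{0} :=
  fun R _ g => Λ * ι₁ R g + ι₂ R g

/-- [OURS] `ι` takes values strictly below `Λ` (the hypothesis on the SECOND key of a lexicographic pair). -/
def IotaBoundedBy (Λ : Ordinal.{0}) (ι : (R : Type) → [CommRing R] → R → Ordinal.{0}) : Prop :=
  ∀ (R : Type) [CommRing R] (g : R), ι R g < Λ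

section Combinator

variable {Λ : Ordinal.{0}} {ι₁ ι₂ : (R : Type) → [CommRing R] → R → Ordinal.{0}}

/-- Unfolding lemma. [OURS] -/
theorem iotaLex_apply (R : Type) [CommRing R] (g : R) : iotaLex Λ ι₁ ι₂ R g = Λ * ι₁ R g + ι₂ R g := rfl

/-- (strat)/(drop) currency, strict form: the pair drops iff the first key drops, or is stationary while the second
drops. [OURS] -/
theorem iotaLex_lt_iff (hb : IotaBoundedBy Λ ι₂) (R : Type) [CommRing R] (g : R) (R' : Type) [CommRing R']
    (g' : R') :
    iotaLex Λ ι₁ ι₂ R g < iotaLex Λ ι₁ ι₂ R' g' ↔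
      ι₁ R g < ι₁ R' g' ∨ (ι₁ R g = ι₁ R' g' ∧ ι₂ R g < ι₂ R' g') :=
  lexPair_lt_iff (hb R g) (hb R' g')

/-- Weak form. [OURS] -/
theorem iotaLex_le_iff (hb : IotaBoundedBy Λ ι₂) (R : Type) [CommRing R] (g : R) (R' : Type) [CommRing R']
    (g' : R') :
    iotaLex Λ ι₁ ι₂ R g ≤ iotaLex Λ ι₁ ι₂ R' g' ↔
      ι₁ R g < ι₁ R' g' ∨ (ι₁ R g = ι₁ R' g' ∧ ι₂ R g ≤ ι₂ R' g') :=
  lexPair_le_iff (hb R g) (hb R' g')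

/-- The pair is stationary iff both keys are. [OURS] -/
theorem iotaLex_eq_iff (hb : IotaBoundedBy Λ ι₂) (R : Type) [CommRing R] (g : R) (R' : Type) [CommRing R']
    (g' : R') :
    iotaLex Λ ι₁ ι₂ R g = iotaLex Λ ι₁ ι₂ R' g' ↔ ι₁ R g = ι₁ R' g' ∧ ι₂ R g = ι₂ R' g' :=
  lexPair_eq_iff (hb R g) (hb R' g')

/-- The first key is monotone along the pair. [OURS] -/
theorem fst_le_of_iotaLex_le (hb : IotaBoundedBy Λ ι₂) {R : Type} [CommRing R] {g : R} {R' : Type} [CommRing R']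
    {g' : R'} (h : iotaLex Λ ι₁ ι₂ R g ≤ iotaLex Λ ι₁ ι₂ R' g') : ι₁ R g ≤ ι₁ R' g' :=
  fst_le_of_lexPair_le (hb R g) (hb R' g') h

/-- Sufficient condition for `≤` of pairs from the keys (the workhorse of the monotonicity transfers). [OURS] -/
theorem iotaLex_le_of (hb : IotaBoundedBy Λ ι₂) {R : Type} [CommRing R] {g : R} {R' : Type} [CommRing R']
    {g' : R'} (h₁ : ι₁ R g ≤ ι₁ R' g') (h₂ : ι₁ R g = ι₁ R' g' → ι₂ R g ≤ ι₂ R' g') :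
    iotaLex Λ ι₁ ι₂ R g ≤ iotaLex Λ ι₁ ι₂ R' g' := by
  rw [iotaLex_le_iff hb]
  rcases h₁.lt_or_eq with h | h
  · exact Or.inl h
  · exact Or.inr ⟨h, h₂ h⟩

/-- Pairings nest: if `ι₁ < Λ₁` and `ι₂ < Λ` everywhere then `iotaLex Λ ι₁ ι₂ < Λ * Λ₁` everywhere, so
`iotaLex (Λ * Λ₁) ι₀ (iotaLex Λ ι₁ ι₂)` is again a lexicographic triple. [OURS] -/
theorem iotaLex_boundedBy {Λ₁ : Ordinal.{0}} (h₁ : IotaBoundedBy Λ₁ ι₁) (hb : IotaBoundedBy Λ ι₂) :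
    IotaBoundedBy (Λ * Λ₁) (iotaLex Λ ι₁ ι₂) :=
  fun R _ g => lexPair_lt_mul (h₁ R g) (hb R g)

/-! ## Clause transfer: (c6), (c12a), (c11) — no bound needed -/

/-- **(c6) transfers**: the lexicographic pair of iso-invariant keys is iso-invariant. [OURS] -/
theorem iotaLex_isoInvariant (h₁ : IotaIsoInvariant ι₁) (h₂ : IotaIsoInvariant ι₂) :
    IotaIsoInvariant (iotaLex Λ ι₁ ι₂) := by
  intro R T _ _ e g
  simp only [iotaLex_apply, h₁ R T e g, h₂ R T e g]

/-- **(c12a) transfers**: the lexicographic pair of unit-invariant keys is unit-invariant. [OURS] -/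
theorem iotaLex_unitInvariant (h₁ : IotaUnitInvariant ι₁) (h₂ : IotaUnitInvariant ι₂) :
    IotaUnitInvariant (iotaLex Λ ι₁ ι₂) := by
  intro R _ v g hv
  simp only [iotaLex_apply, h₁ R v g hv, h₂ R v g hv]

/-- **(c11) transfers** (ι-half): if `(ι₁, J)` and `(ι₂, J')` are compatible with essentially smooth local
homomorphisms of regular local rings, so is `(iotaLex Λ ι₁ ι₂, J)`. [OURS] -/
theorem iotaLex_essSmoothCompatible {J J' : (R : Type) → [CommRing R] → R → ℕ → Ideal R}
    (h₁ : IotaJEssSmoothCompatible ι₁ J) (h₂ : IotaJEssSmoothCompatible ι₂ J') :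
    IotaJEssSmoothCompatible (iotaLex Λ ι₁ ι₂) J := by
  intro S S' _ _ _ _ _ _ _ _ f
  obtain ⟨e₁, hJ⟩ := h₁ S S' f
  obtain ⟨e₂, -⟩ := h₂ S S' f
  refine ⟨?_, hJ⟩
  simp only [iotaLex_apply, e₁, e₂]

/-! ## Clause transfer: (c7) and (c10) — stratum-conditional monotonicity of the second key -/

/-- [OURS] Stratum-conditional (c7) for the second key: on a REGULAR local ring `S`, at primes `𝔭` where the first key
is stationary under generization, the second key does not increase. (Implied by `IotaGenerizationMonotone ι₂`;
secondary invariants typically satisfy only this.) -/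
def IotaGenerizationMonotoneOn (ι₁ ι₂ : (R : Type) → [CommRing R] → R → Ordinal.{0}) : Prop :=
  ∀ (S : Type) [CommRing S] [IsRegularLocalRing S] (𝔭 : Ideal S) [𝔭.IsPrime] (f : S),
    ι₁ (Localization.AtPrime 𝔭) (algebraMap S (Localization.AtPrime 𝔭) f) = ι₁ S f →
    ι₂ (Localization.AtPrime 𝔭) (algebraMap S (Localization.AtPrime 𝔭) f) ≤ ι₂ S f

/-- [OURS] Stratum-conditional (c10) for the second key: at primes `𝔮 ⊂ S[X]` over `𝔪_S` where the first key is
stationary, the second key does not increase. (Implied by `IotaTorusFactorMonotone ι₂`.) -/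
def IotaTorusFactorMonotoneOn (ι₁ ι₂ : (R : Type) → [CommRing R] → R → Ordinal.{0}) : Prop :=
  ∀ (S : Type) [CommRing S] [IsRegularLocalRing S] (f : S) (𝔮 : Ideal (Polynomial S)) [𝔮.IsPrime],
    𝔮.comap (Polynomial.C : S →+* Polynomial S) = IsLocalRing.maximalIdeal S →
    ι₁ (Localization.AtPrime 𝔮) (algebraMap (Polynomial S) (Localization.AtPrime 𝔮) (Polynomial.C f)) = ι₁ S f →
    ι₂ (Localization.AtPrime 𝔮) (algebraMap (Polynomial S) (Localization.AtPrime 𝔮) (Polynomial.C f)) ≤ ι₂ S f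

/-- The plain clause implies the stratum-conditional one. [OURS] -/
theorem iotaGenerizationMonotoneOn_of (h₂ : IotaGenerizationMonotone ι₂) : IotaGenerizationMonotoneOn ι₁ ι₂ :=
  fun S _ _ 𝔭 _ f _ => h₂ S 𝔭 f

/-- The plain clause implies the stratum-conditional one. [OURS] -/
theorem iotaTorusFactorMonotoneOn_of (h₂ : IotaTorusFactorMonotone ι₂) : IotaTorusFactorMonotoneOn ι₁ ι₂ :=
  fun S _ _ f 𝔮 _ h𝔮 _ => h₂ S f 𝔮 h𝔮

/-- **(c7) transfers**: generization-monotone first key + stratum-conditionally monotone bounded second key ⇒ the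
pair is generization-monotone on regular local rings. [OURS] -/
theorem iotaLex_generizationMonotone (hb : IotaBoundedBy Λ ι₂) (h₁ : IotaGenerizationMonotone ι₁)
    (h₂ : IotaGenerizationMonotoneOn ι₁ ι₂) : IotaGenerizationMonotone (iotaLex Λ ι₁ ι₂) := by
  intro S _ _ 𝔭 _ f
  exact iotaLex_le_of hb (h₁ S 𝔭 f) (h₂ S 𝔭 f)

/-- (c7) transfers, unconditional second key. [OURS] -/
theorem iotaLex_generizationMonotone_of (hb : IotaBoundedBy Λ ι₂) (h₁ : IotaGenerizationMonotone ι₁)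
    (h₂ : IotaGenerizationMonotone ι₂) : IotaGenerizationMonotone (iotaLex Λ ι₁ ι₂) :=
  iotaLex_generizationMonotone hb h₁ (iotaGenerizationMonotoneOn_of h₂)

/-- **(c10) transfers**: torus-factor-monotone first key + stratum-conditionally monotone bounded second key ⇒ the
pair is torus-factor-monotone. [OURS] -/
theorem iotaLex_torusFactorMonotone (hb : IotaBoundedBy Λ ι₂) (h₁ : IotaTorusFactorMonotone ι₁)
    (h₂ : IotaTorusFactorMonotoneOn ι₁ ι₂) : IotaTorusFactorMonotone (iotaLex Λ ι₁ ι₂) := by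
  intro S _ _ f 𝔮 _ h𝔮
  exact iotaLex_le_of hb (h₁ S f 𝔮 h𝔮) (h₂ S f 𝔮 h𝔮)

/-- (c10) transfers, unconditional second key. [OURS] -/
theorem iotaLex_torusFactorMonotone_of (hb : IotaBoundedBy Λ ι₂) (h₁ : IotaTorusFactorMonotone ι₁)
    (h₂ : IotaTorusFactorMonotone ι₂) : IotaTorusFactorMonotone (iotaLex Λ ι₁ ι₂) :=
  iotaLex_torusFactorMonotone hb h₁ (iotaTorusFactorMonotoneOn_of h₂)

/-! ## Clause transfer: (c8) — the second key need only be semicontinuous along the strata of the first -/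

/-- [OURS] Stratum-relative (c8) for the second key: on a smooth quasi-compact scheme `Y` over a field, for every
global function `f` and ordinals `α, β`, the set `{y | ι₁ = α ∧ β ≤ ι₂}` (values at the stalk germs of `f`) is CLOSED IN
THE STRATUM `{y | ι₁ = α}` — stated as: it is the trace on the stratum of a closed subset of `Y` (equivalently,
by `isClosed_induced_iff`, its preimage in the subtype `{y // ι₁ = α}` is closed).  Implied by `IotaUpperSemicontinuous ι₂`; secondary invariants (order of a
coefficient ideal on a hypersurface of maximal contact, Hilbert–Samuel-type refinements) are only of this kind. -/
def IotaUpperSemicontinuousOn (ι₁ ι₂ : (R : Type) → [CommRing R] → R → Ordinal.{0}) : Prop :=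
  ∀ (k₀ : Type) [Field k₀] (Y : Scheme.{0}) (hY : Y ⟶ Spec (CommRingCat.of k₀)) [Smooth hY] [QuasiCompact hY]
    (f : Γ(Y, ⊤)) (α β : Ordinal.{0}),
    ∃ C : Set ↥Y, IsClosed C ∧
      C ∩ {y : ↥Y | ι₁ (Y.presheaf.stalk y) (Y.presheaf.germ ⊤ y trivial f) = α} =
        {y : ↥Y | ι₁ (Y.presheaf.stalk y) (Y.presheaf.germ ⊤ y trivial f) = α ∧
          β ≤ ι₂ (Y.presheaf.stalk y) (Y.presheaf.germ ⊤ y trivial f)}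

/-- The plain clause (c8) for the second key implies the stratum-relative one (`C := {β ≤ ι₂}`). [OURS] -/
theorem iotaUpperSemicontinuousOn_of (h₂ : IotaUpperSemicontinuous ι₂) : IotaUpperSemicontinuousOn ι₁ ι₂ := by
  intro k₀ _ Y hY _ _ f α β
  refine ⟨{y : ↥Y | β ≤ ι₂ (Y.presheaf.stalk y) (Y.presheaf.germ ⊤ y trivial f)}, h₂ k₀ Y hY f β, ?_⟩
  ext y
  simp only [Set.mem_inter_iff, Set.mem_setOf_eq]
  tauto

/-- Point-set kernel of the (c8) transfer: if `A` and `F` are closed, `E ⊆ F ⊆ A ∪ E`, and `T = C ∩ E` is the trace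
of a closed set `C` on `E`, then `A ∪ T = A ∪ (C ∩ F)` is closed (below: `A = {a < φ₁}`, `F = {a ≤ φ₁}`,
`E = {φ₁ = a}`). [folklore] -/
theorem isClosed_union_of_trace {X : Type*} [TopologicalSpace X] {A F C T E : Set X} (hA : IsClosed A)
    (hF : IsClosed F) (hC : IsClosed C) (hCE : C ∩ E = T) (hEF : E ⊆ F) (hFAE : F ⊆ A ∪ E) :
    IsClosed (A ∪ T) := by
  have h : A ∪ T = A ∪ (C ∩ F) := by
    apply le_antisymm
    · rintro x (hx | hx)
      · exact Or.inl hx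
      · rw [← hCE] at hx
        exact Or.inr ⟨hx.1, hEF hx.2⟩
    · rintro x (hx | ⟨hxC, hxF⟩)
      · exact Or.inl hx
      · rcases hFAE hxF with hxA | hxE
        · exact Or.inl hxA
        · right; rw [← hCE]; exact ⟨hxC, hxE⟩
  rw [h]
  exact hA.union (hC.inter hF)

/-- **(c8) transfers**: if the first key is upper semicontinuous on smooth quasi-compact schemes over a field, the
second key is bounded by `Λ ≠ 0` and upper semicontinuous ALONG THE STRATA of the first key, then the lexicographic pair
is upper semicontinuous.  Proof: write `γ = Λ·a + b` with `a = γ / Λ`, `b = γ % Λ < Λ`; then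
`{γ ≤ Λ·ι₁ + ι₂} = {a < ι₁} ∪ {ι₁ = a ∧ b ≤ ι₂}`, `{a < ι₁} = {a + 1 ≤ ι₁}` and `{a ≤ ι₁}` are closed by (c8) for `ι₁`,
and the second piece is the trace of a closed set on the stratum `{ι₁ = a} = {a ≤ ι₁} ∖ {a < ι₁}`. [OURS] -/
theorem iotaLex_upperSemicontinuous (hΛ : Λ ≠ 0) (hb : IotaBoundedBy Λ ι₂) (h₁ : IotaUpperSemicontinuous ι₁)
    (h₂ : IotaUpperSemicontinuousOn ι₁ ι₂) : IotaUpperSemicontinuous (iotaLex Λ ι₁ ι₂) := by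
  intro k₀ _ Y hY _ _ f γ
  -- abbreviations for the two keys at the stalks
  set φ₁ : ↥Y → Ordinal.{0} := fun y => ι₁ (Y.presheaf.stalk y) (Y.presheaf.germ ⊤ y trivial f) with hφ₁
  set φ₂ : ↥Y → Ordinal.{0} := fun y => ι₂ (Y.presheaf.stalk y) (Y.presheaf.germ ⊤ y trivial f) with hφ₂
  set a : Ordinal.{0} := γ / Λ with ha
  set b : Ordinal.{0} := γ % Λ with hb_def
  have hγ : γ = Λ * a + b := (Ordinal.div_add_mod γ Λ).symm
  have hbΛ : b < Λ := Ordinal.mod_lt γ hΛ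
  obtain ⟨C, hC, hCE⟩ := h₂ k₀ Y hY f a b
  have hA : IsClosed {y : ↥Y | a + 1 ≤ φ₁ y} := h₁ k₀ Y hY f (a + 1)
  have hF : IsClosed {y : ↥Y | a ≤ φ₁ y} := h₁ k₀ Y hY f a
  have key : {y : ↥Y | γ ≤ iotaLex Λ ι₁ ι₂ (Y.presheaf.stalk y) (Y.presheaf.germ ⊤ y trivial f)} =
      {y : ↥Y | a + 1 ≤ φ₁ y} ∪ {y : ↥Y | φ₁ y = a ∧ b ≤ φ₂ y} := by
    ext y
    simp only [Set.mem_setOf_eq, Set.mem_union, iotaLex_apply]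
    rw [hγ, lexPair_le_iff hbΛ (hb _ _), Order.add_one_le_iff]
    constructor
    · rintro (h | ⟨h1, h2⟩)
      · exact Or.inl h
      · exact Or.inr ⟨h1.symm, h2⟩
    · rintro (h | ⟨h1, h2⟩)
      · exact Or.inl h
      · exact Or.inr ⟨h1.symm, h2⟩
  rw [key]
  refine isClosed_union_of_trace (E := {y : ↥Y | φ₁ y = a}) (F := {y : ↥Y | a ≤ φ₁ y}) hA hF hC hCE ?_ ?_
  · intro y hy
    exact le_of_eq (Eq.symm hy)
  · intro y hy
    have hy' : a ≤ φ₁ y := hy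
    rcases hy'.lt_or_eq with h | h
    · exact Or.inl (Order.add_one_le_of_lt h)
    · exact Or.inr h.symm

/-- (c8) transfers, unconditional second key. [OURS] -/
theorem iotaLex_upperSemicontinuous_of (hΛ : Λ ≠ 0) (hb : IotaBoundedBy Λ ι₂) (h₁ : IotaUpperSemicontinuous ι₁)
    (h₂ : IotaUpperSemicontinuous ι₂) : IotaUpperSemicontinuous (iotaLex Λ ι₁ ι₂) :=
  iotaLex_upperSemicontinuous hΛ hb h₁ (iotaUpperSemicontinuousOn_of h₂)

end Combinator

/-! ## First key = the order function `iotaOrd` (p502169): refinements `iotaLex Λ iotaOrd ι₂` -/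

section FirstKeyOrder

variable {Λ : Ordinal.{0}} {ι₂ : (R : Type) → [CommRing R] → R → Ordinal.{0}}

/-- The order function is bounded by `ω + 1` (`iotaOrd ≤ ω`, value `ω` exactly at germs lying in every power of `𝔪`).
So `iotaOrd` may also serve as a SECOND key, with base `ω + 1`. [OURS] -/
theorem iotaOrd_boundedBy : IotaBoundedBy (Ordinal.omega0 + 1) iotaOrd :=
  fun R _ g => Order.lt_add_one_iff.2 (iotaOrd_le_omega0 R g)

/-- (c6) for every refinement of the order by an iso-invariant second key. [OURS] -/
theorem iotaLex_iotaOrd_isoInvariant (h₂ : IotaIsoInvariant ι₂) : IotaIsoInvariant (iotaLex Λ iotaOrd ι₂) :=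
  iotaLex_isoInvariant iotaOrd_isoInvariant h₂

/-- (c12a) for every refinement of the order by a unit-invariant second key. [OURS] -/
theorem iotaLex_iotaOrd_unitInvariant (h₂ : IotaUnitInvariant ι₂) : IotaUnitInvariant (iotaLex Λ iotaOrd ι₂) :=
  iotaLex_unitInvariant iotaOrd_unitInvariant h₂

/-- (c7) for every refinement of the order by a bounded second key that does not increase under generizations
keeping the order (regular local rings). [OURS] -/
theorem iotaLex_iotaOrd_generizationMonotone (hb : IotaBoundedBy Λ ι₂) (h₂ : IotaGenerizationMonotoneOn iotaOrd ι₂) :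
    IotaGenerizationMonotone (iotaLex Λ iotaOrd ι₂) :=
  iotaLex_generizationMonotone hb iotaOrd_generizationMonotone h₂

/-- (c10) for every refinement of the order by a bounded second key that does not increase along torus factors
keeping the order. [OURS] -/
theorem iotaLex_iotaOrd_torusFactorMonotone (hb : IotaBoundedBy Λ ι₂) (h₂ : IotaTorusFactorMonotoneOn iotaOrd ι₂) :
    IotaTorusFactorMonotone (iotaLex Λ iotaOrd ι₂) :=
  iotaLex_torusFactorMonotone hb iotaOrd_torusFactorMonotone h₂

/-- **(c8) for every refinement of the order** by a bounded second key that is upper semicontinuous along the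
order strata of smooth quasi-compact schemes over a field (first-key semicontinuity: res-type-039's
`iotaOrd_upperSemicontinuous`, p502844). This is tri-2's «invariant of the embedded top locus, semicontinuous on the
max-ord stratum» made precise as a proof obligation. [OURS] -/
theorem iotaLex_iotaOrd_upperSemicontinuous (hΛ : Λ ≠ 0) (hb : IotaBoundedBy Λ ι₂)
    (h₂ : IotaUpperSemicontinuousOn iotaOrd ι₂) : IotaUpperSemicontinuous (iotaLex Λ iotaOrd ι₂) :=
  iotaLex_upperSemicontinuous hΛ hb iotaOrd_upperSemicontinuous h₂

end FirstKeyOrder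

end Summit.ResolutionOfSingularities.ResolutionOfSingularities.Cruxes.HypersurfaceCentreConstruction.LocalEngine

end
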